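import Summits.QuantumFields.BalabanUV.T4Continuum.Support.AveragingDeficitDualResidual

/-!
# AveragingDeficitTorusChart (T⁴ programme, node NE3, row NE3-R2, gen 3) — THE FINITE TORUS PARAMETER SPACE AND THE
# EXPONENTIAL CHART `ψ ↦ V e^{Pψ}` FOR BAŁABAN'S CONFIGURATIONS (file 1/3 of R0 = Fermat on the composite-constraint
# manifold; file 2/3 `AveragingDeficitChartCalculus` = smoothness of (42) in the chart, file 3/3 `AveragingDeficitFermat`)

HONEST FRAMING (cell `pub-balaban`, T4-DAG PAGE 1; unit `b2b-balaban-t4-ne3r2-p1` = owner of BINDER-OWNERS row NE3-R2,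
gen 3).  The cell's T4 target is the finite-torus continuum limit of the unit-scale averaged loop expectations — NOT
infinite volume, NO mass gap, NOT Clay, NOT summit progress.  Gen 2 assembled R2ᴱ of the NE3 energy route for the
non-linear average on the torus (`AveragingDeficitDualResidual.dualResidual_torus`) MODULO the hypothesis shape
`FineCritical` (item R0 of the record: the constrained minimiser is critical along every lifted direction).  R0 is
Fermat's theorem on the manifold cut out of the periodic `U(N)` configurations by a constraint imposed THROUGH the
average; the Lagrange-multiplier argument needs a genuine finite-dimensional parameter space.  THIS FILE supplies it, all
[folklore], 0 sorry: §1 the torus index `[0,N)^d` (`redN`, `coe_redN`, `boxVec_redN`, `redN_boxVec`, `redN_add_smul`,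
`eq_wrap_add`), periodicity along arbitrary period-lattice vectors (`periodic_smul_vec` — from periodicity along the
`N e_κ`), the parameter space `TDir d n N = (Fin d → Fin N) → Fin d → 𝕄` (a finite-dimensional real normed space in the
operator norm (19)), periodic extension / restriction (`extDir`, `resDir`, `resDir_extDir`, `extDir_resDir`); §2 the
`ℝ`-linear projection `skewP : 𝕄 →L[ℝ] 𝕄`, `X ↦ (X − X†)/2`, onto `𝔲(N)` (`skewP_mem`, `skewP_of_mem`); §3 THE CHART
`chart P N V ψ (x,κ) = V(x,κ)·exp(P ψ(x mod N, κ))` with a linear insert `P` (`P = skewP`: a chart of the periodic `U(N)`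
configurations at `V`; `P = id`: a full chart of the periodic `GL(N)` configurations), its direction field `chartDir`,
**`chart_smul : chart (s•ψ) = vary V (chartDir ψ) s`** (the dictionary with the tree's one-parameter families
`T4AveragingDeficitWall.vary`), `chart_zero`, `chart_eq_vary_one`, periodicity (`isPeriodicDir_chartDir`,
`isPeriodicCfg_chart`, along every period-lattice vector: `chart_add_smul`), unitarity (`isUnitaryCfg_chart`, via the
tree's `vary_isUnitaryCfg`), and the identification of a periodic (`𝔲(N)`) direction field with the chart direction of its
restriction (`chartDir_id_resDir`, `chartDir_skewP_resDir`).
NE3 ITSELF IS NOT PROVED: NE3(A) ⇐ ML ∧ R0 ∧ β ∧ γ (record `t4/T4-EST-NE3-P2.md` §0 (e)); NE3 stays COND-free.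
CITATION HEADER: no printed sentence is a hypothesis; the manuscripts under audit are not cited for any disputed step;
context: T. Bałaban, Commun. Math. Phys. **98** (1985) 17–51 [Balaban1985Averaging] ((42) p. 23); **102** (1985)
277–309 [Balaban1985Variational] ((75)–(77) p. 289: the parametrisation `U = U₀e^{iA}` of configurations near a background).
PLACEMENT: `Summits/QuantumFields/BalabanUV/` (human rule 2026-08-19).  Record: HOME `t4/T4-EST-NE3-R2.md` v0.4.
-/

set_option autoImplicit false

open scoped BigOperators Matrix Matrix.Norms.L2Operator Topology
open NormedSpace Finset Filter

namespace Summit.QuantumFields.BalabanUV.T4Continuum.AveragingDeficitTorusChart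

open Literature.MathematicalPhysics.QuantumFieldTheory.Balaban1983to89
open B7Prop1Explicit B7Prop2Explicit MatrixLog UnitaryModel
open T4AveragingDeficitWall hiding Site Plane Plaq Bond
open T4AveragingDeficitWallBoundary (IsPeriodicCfg)
open T4AveragingDeficitNonAbelian (hol_add_period)
open AveragingDeficitTransport AveragingDeficitPlaqDeriv AveragingDeficitSideDeriv AveragingDeficitPeriodicCounting
open AveragingDeficitResidualPairing

noncomputable section

variable {d : ℕ} {n : Type*} [Fintype n] [DecidableEq n]

local notation "𝕄" => Matrix n n ℂ
local notation "Site" => B7Prop1Explicit.Site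

/-! ## §1 The torus index, periodicity along lattice vectors, periodic extension and restriction -/

/-- Reduction of a site of `ℤ^d` modulo `N` to the torus index `[0,N)^d`. [folklore] -/
def redN (N : ℕ) [NeZero N] (x : Site d) : Fin d → Fin N :=
  fun i => ⟨(x i % (N : ℤ)).toNat % N, Nat.mod_lt _ (Nat.pos_of_ne_zero (NeZero.ne N))⟩

omit [Fintype n] [DecidableEq n] in
/-- The coordinates of `redN N x` are the residues `x_i mod N`. [folklore] -/
theorem coe_redN (N : ℕ) [NeZero N] (x : Site d) (i : Fin d) : ((redN N x i : ℕ) : ℤ) = x i % (N : ℤ) := by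
  have hN : (0 : ℤ) < N := by exact_mod_cast Nat.pos_of_ne_zero (NeZero.ne N)
  have h0 : 0 ≤ x i % (N : ℤ) := Int.emod_nonneg _ hN.ne'
  have h1 : x i % (N : ℤ) < N := Int.emod_lt_of_pos _ hN
  have h2 : (x i % (N : ℤ)).toNat < N := by omega
  simp only [redN, Nat.mod_eq_of_lt h2]
  omega

omit [Fintype n] [DecidableEq n] in
/-- `boxVec N (redN N x)` is the wrap of `x` into `[0,N)^d`. [folklore] -/
theorem boxVec_redN (N : ℕ) [NeZero N] (x : Site d) : boxVec N (redN N x) = fun i => x i % (N : ℤ) := by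
  funext i
  simp only [boxVec]
  exact coe_redN N x i

omit [Fintype n] [DecidableEq n] in
/-- `redN` is a left inverse of `boxVec`. [folklore] -/
theorem redN_boxVec (N : ℕ) [NeZero N] (r : Fin d → Fin N) : redN N (boxVec N r) = r := by
  funext i
  apply Fin.ext
  have h := coe_redN N (boxVec (d := d) N r) i
  have hr : ((boxVec (d := d) N r) i) % (N : ℤ) = r i := by
    simp only [boxVec]
    exact Int.emod_eq_of_lt (by positivity) (by exact_mod_cast (r i).isLt)
  rw [hr] at h
  exact_mod_cast h

omit [Fintype n] [DecidableEq n] in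
/-- `redN` is invariant under the period lattice `N·ℤ^d`. [folklore] -/
theorem redN_add_smul (N : ℕ) [NeZero N] (x k : Site d) : redN N (x + (N : ℤ) • k) = redN N x := by
  funext i
  apply Fin.ext
  have h1 := coe_redN N (x + (N : ℤ) • k) i
  have h2 := coe_redN N x i
  simp only [Pi.add_apply, Pi.smul_apply, smul_eq_mul] at h1
  rw [Int.add_mul_emod_self_left] at h1
  exact_mod_cast h1.trans h2.symm

omit [Fintype n] [DecidableEq n] in
/-- Every site is its wrap plus a period-lattice vector. [folklore] -/
theorem eq_wrap_add (N : ℕ) [NeZero N] (x : Site d) :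
    x = boxVec N (redN N x) + (N : ℤ) • (fun i => x i / (N : ℤ)) := by
  funext i
  simp only [boxVec_redN, Pi.add_apply, Pi.smul_apply, smul_eq_mul]
  have := Int.emod_add_mul_ediv (x i) (N : ℤ)
  linarith

omit [Fintype n] [DecidableEq n] in
/-- A lattice vector is the sum of its coordinates times the unit vectors. [folklore] -/
theorem eq_sum_smul_e (k : Site d) : k = ∑ i, k i • e i := by
  funext j
  simp only [Finset.sum_apply, Pi.smul_apply, e, Pi.single_apply, smul_eq_mul, mul_ite, mul_one, mul_zero,
    Finset.sum_ite_eq, Finset.mem_univ, if_true]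

omit [Fintype n] [DecidableEq n] in
/-- **A function periodic along every `N e_κ` is periodic along every period-lattice vector `N k`.** [folklore] -/
theorem periodic_smul_vec {α : Type*} {f : Site d → α} {N : ℤ} (hf : ∀ (x : Site d) (κ : Fin d), f (x + N • e κ) = f x)
    (x k : Site d) : f (x + N • k) = f x := by
  classical
  have hone : ∀ (i : Fin d) (m : ℤ) (x : Site d), f (x + N • (m • e i)) = f x := by
    intro i m
    induction m using Int.induction_on with
    | zero => intro x; simp
    | succ m ih =>
        intro x
        have e1 : x + N • (((m : ℤ) + 1) • e i) = (x + N • ((m : ℤ) • e i)) + N • e i := by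
          rw [add_smul, one_smul, smul_add, add_assoc]
        rw [e1, hf, ih]
    | pred m ih =>
        intro x
        have e1 : x + N • ((-(m : ℤ) - 1) • e i) + N • e i = x + N • ((-(m : ℤ)) • e i) := by
          rw [sub_smul, one_smul, smul_sub, add_assoc, sub_add_cancel]
        have h := hf (x + N • ((-(m : ℤ) - 1) • e i)) i
        rw [e1, ih] at h
        exact h.symm
  have key : ∀ (s : Finset (Fin d)) (x : Site d), f (x + N • ∑ i ∈ s, k i • e i) = f x := by
    intro s
    induction s using Finset.induction_on with
    | empty => intro x; simp
    | insert i s hi ih =>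
        intro x
        rw [Finset.sum_insert hi, smul_add, ← add_assoc, add_right_comm, hone i (k i), ih]
  conv_lhs => rw [eq_sum_smul_e k]
  exact key Finset.univ x

variable (d n) in
/-- Direction fields on the bonds of the torus `[0,N)^d` — THE FINITE-DIMENSIONAL PARAMETER SPACE of the chart. [folklore] -/
abbrev TDir (N : ℕ) : Type _ := (Fin d → Fin N) → Fin d → 𝕄

/-- Periodic extension of torus data to a direction field on `ℤ^d`. [folklore] -/
def extDir (N : ℕ) [NeZero N] (ψ : TDir d n N) : Site d → Fin d → 𝕄 := fun x κ => ψ (redN N x) κ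

/-- Restriction of a direction field on `ℤ^d` to the torus bonds. [folklore] -/
def resDir (N : ℕ) (φ : Site d → Fin d → 𝕄) : TDir d n N := fun r κ => φ (boxVec N r) κ

omit [Fintype n] [DecidableEq n] in
/-- The periodic extension is invariant under the period lattice. [folklore] -/
theorem extDir_add_smul (N : ℕ) [NeZero N] (ψ : TDir d n N) (x k : Site d) (κ : Fin d) :
    extDir N ψ (x + (N : ℤ) • k) κ = extDir N ψ x κ := by
  simp only [extDir, redN_add_smul]

omit [Fintype n] [DecidableEq n] in
/-- The periodic extension is a periodic direction field. [folklore] -/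
theorem isPeriodicDir_extDir (N : ℕ) [NeZero N] (ψ : TDir d n N) : IsPeriodicDir (extDir N ψ) (N : ℤ) :=
  fun x κ μ => extDir_add_smul N ψ x (e κ) μ

omit [Fintype n] [DecidableEq n] in
/-- `resDir ∘ extDir = id`. [folklore] -/
theorem resDir_extDir (N : ℕ) [NeZero N] (ψ : TDir d n N) : resDir N (extDir N ψ) = ψ := by
  funext r κ
  simp only [resDir, extDir, redN_boxVec]

omit [Fintype n] [DecidableEq n] in
/-- `extDir ∘ resDir = id` on periodic fields. [folklore] -/
theorem extDir_resDir (N : ℕ) [NeZero N] {φ : Site d → Fin d → 𝕄} (hφ : IsPeriodicDir φ (N : ℤ)) :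
    extDir N (resDir N φ) = φ := by
  funext x κ
  simp only [extDir, resDir]
  conv_rhs => rw [eq_wrap_add N x]
  exact (periodic_smul_vec (f := fun y => φ y κ) (fun y i => hφ y i κ) _ _).symm

/-! ## §2 The `ℝ`-linear projection onto `𝔲(N)` -/

/-- `X ↦ (X − X†)/2` as an `ℝ`-linear map. [folklore] -/
def skewPₗ : 𝕄 →ₗ[ℝ] 𝕄 where
  toFun X := (2 : ℂ)⁻¹ • (X - star X)
  map_add' X Y := by
    simp only [star_add]
    rw [← smul_add]
    congr 1
    abel
  map_smul' r X := by
    simp only [star_smul, star_trivial, RingHom.id_apply, ← smul_sub, smul_comm r]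

/-- THE PROJECTION `skewP : 𝕄 →L[ℝ] 𝕄` onto the skew-adjoint matrices, `skewP X = (X − X†)/2`. [folklore] -/
def skewP : 𝕄 →L[ℝ] 𝕄 := LinearMap.toContinuousLinearMap skewPₗ

omit [DecidableEq n] in
/-- `skewP X = (X − X†)/2`. [folklore] -/
theorem skewP_apply (X : 𝕄) : skewP X = (2 : ℂ)⁻¹ • (X - star X) := rfl

omit [DecidableEq n] in
/-- `skewP` lands in `𝔲(N)`. [folklore] -/
theorem skewP_mem (X : 𝕄) : skewP X ∈ skewAdjoint 𝕄 := by
  rw [skewAdjoint.mem_iff, skewP_apply, star_smul, star_sub, star_star, ← smul_neg, neg_sub]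
  congr 1
  simp

omit [DecidableEq n] in
/-- `skewP` is the identity on `𝔲(N)`. [folklore] -/
theorem skewP_of_mem {X : 𝕄} (hX : X ∈ skewAdjoint 𝕄) : skewP X = X := by
  rw [skewAdjoint.mem_iff] at hX
  rw [skewP_apply, hX, sub_neg_eq_add, ← two_smul ℂ X, smul_smul, inv_mul_cancel₀ two_ne_zero, one_smul]

/-! ## §3 The chart `ψ ↦ V e^{Pψ}` on the torus parameter space -/

/-- The direction field of the chart parameter `ψ` (with linear insert `P`): `(x,κ) ↦ P ψ(x mod N, κ)`. [folklore] -/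
def chartDir (P : 𝕄 →L[ℝ] 𝕄) (N : ℕ) [NeZero N] (ψ : TDir d n N) : Site d → Fin d → 𝕄 :=
  fun x κ => P (ψ (redN N x) κ)

/-- THE CHART at `V`: `chart P N V ψ (x,κ) = V(x,κ) · exp(P ψ(x mod N, κ))` (B11's parametrisation `U = U₀ e^{iA}` of
(75)–(77), here right-multiplied and on the finite torus). [cite: Balaban1985Variational, (75)–(77) p.289] -/
def chart (P : 𝕄 →L[ℝ] 𝕄) (N : ℕ) [NeZero N] (V : Site d → Fin d → 𝕄ˣ) (ψ : TDir d n N) : Site d → Fin d → 𝕄ˣ :=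
  fun x κ => V x κ * expUnit (chartDir P N ψ x κ)

omit [Fintype n] [DecidableEq n] in
/-- `chartDir` is linear in the parameter along rays: `chartDir (s•ψ) = s·chartDir ψ`. [folklore] -/
theorem chartDir_smul (P : 𝕄 →L[ℝ] 𝕄) (N : ℕ) [NeZero N] (s : ℝ) (ψ : TDir d n N) (x : Site d) (κ : Fin d) :
    chartDir P N (s • ψ) x κ = (s : ℂ) • chartDir P N ψ x κ := by
  simp only [chartDir, Pi.smul_apply, map_smul, Complex.coe_smul]

/-- **THE DICTIONARY WITH THE ONE-PARAMETER FAMILIES**: `chart (s•ψ) = vary V (chartDir ψ) s`. [folklore] -/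
theorem chart_smul (P : 𝕄 →L[ℝ] 𝕄) (N : ℕ) [NeZero N] (V : Site d → Fin d → 𝕄ˣ) (s : ℝ) (ψ : TDir d n N) :
    chart P N V (s • ψ) = vary V (chartDir P N ψ) s := by
  funext x κ
  simp only [chart, vary, chartDir_smul]

/-- `chart 0 = V`. [folklore] -/
@[simp] theorem chart_zero (P : 𝕄 →L[ℝ] 𝕄) (N : ℕ) [NeZero N] (V : Site d → Fin d → 𝕄ˣ) : chart P N V 0 = V := by
  have h := chart_smul P N V 0 (0 : TDir d n N)
  rw [zero_smul, vary_zero] at h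
  exact h

/-- `chart ψ = vary V (chartDir ψ) 1`. [folklore] -/
theorem chart_eq_vary_one (P : 𝕄 →L[ℝ] 𝕄) (N : ℕ) [NeZero N] (V : Site d → Fin d → 𝕄ˣ) (ψ : TDir d n N) :
    chart P N V ψ = vary V (chartDir P N ψ) 1 := by
  rw [← chart_smul, one_smul]

omit [Fintype n] [DecidableEq n] in
/-- The chart direction field is `N`-periodic. [folklore] -/
theorem chartDir_add_smul (P : 𝕄 →L[ℝ] 𝕄) (N : ℕ) [NeZero N] (ψ : TDir d n N) (x k : Site d) (κ : Fin d) :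
    chartDir P N ψ (x + (N : ℤ) • k) κ = chartDir P N ψ x κ := by
  simp only [chartDir, redN_add_smul]

omit [Fintype n] [DecidableEq n] in
/-- The chart direction field is a periodic direction. [folklore] -/
theorem isPeriodicDir_chartDir (P : 𝕄 →L[ℝ] 𝕄) (N : ℕ) [NeZero N] (ψ : TDir d n N) :
    IsPeriodicDir (chartDir P N ψ) (N : ℤ) := fun x κ μ => chartDir_add_smul P N ψ x (e κ) μ

/-- The chart of a periodic configuration is periodic (along every period-lattice vector). [folklore] -/
theorem chart_add_smul (P : 𝕄 →L[ℝ] 𝕄) (N : ℕ) [NeZero N] {V : Site d → Fin d → 𝕄ˣ}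
    (hV : IsPeriodicCfg V (N : ℤ)) (ψ : TDir d n N) (x k : Site d) (κ : Fin d) :
    chart P N V ψ (x + (N : ℤ) • k) κ = chart P N V ψ x κ := by
  simp only [chart, chartDir_add_smul, periodic_smul_vec (f := fun y => V y κ) (fun y i => hV y i κ)]

/-- The chart of a periodic configuration is a periodic configuration. [folklore] -/
theorem isPeriodicCfg_chart (P : 𝕄 →L[ℝ] 𝕄) (N : ℕ) [NeZero N] {V : Site d → Fin d → 𝕄ˣ}
    (hV : IsPeriodicCfg V (N : ℤ)) (ψ : TDir d n N) : IsPeriodicCfg (chart P N V ψ) (N : ℤ) :=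
  fun x κ μ => chart_add_smul P N hV ψ x (e κ) μ

omit [DecidableEq n] in
/-- With the insert `skewP` the chart direction is `𝔲(N)`-valued. [folklore] -/
theorem isSkewDir_chartDir (N : ℕ) [NeZero N] (ψ : TDir d n N) : IsSkewDir (chartDir skewP N ψ) :=
  fun _ _ => skewP_mem _

/-- With the insert `skewP` the chart of a `U(N)` configuration is a `U(N)` configuration. [folklore] -/
theorem isUnitaryCfg_chart (N : ℕ) [NeZero N] {V : Site d → Fin d → 𝕄ˣ} (hV : IsUnitaryCfg V) (ψ : TDir d n N) :
    IsUnitaryCfg (chart skewP N V ψ) := by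
  rw [chart_eq_vary_one]
  exact vary_isUnitaryCfg hV (isSkewDir_chartDir N ψ) 1

omit [DecidableEq n] in
/-- A periodic `𝔲(N)` direction field is the chart direction of its restriction (insert `skewP`). [folklore] -/
theorem chartDir_skewP_resDir (N : ℕ) [NeZero N] {ψ : Site d → Fin d → 𝕄} (hψP : IsPeriodicDir ψ (N : ℤ))
    (hψs : IsSkewDir ψ) : chartDir skewP N (resDir N ψ) = ψ := by
  have h := extDir_resDir N hψP
  funext x κ
  have hx := congr_fun (congr_fun h x) κ
  simp only [extDir] at hx
  simp only [chartDir, resDir]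
  rw [← hx]
  exact skewP_of_mem (hψs _ _)

omit [Fintype n] [DecidableEq n] in
/-- A periodic direction field is the chart direction of its restriction (insert `id`). [folklore] -/
theorem chartDir_id_resDir (N : ℕ) [NeZero N] {ψ : Site d → Fin d → 𝕄} (hψP : IsPeriodicDir ψ (N : ℤ)) :
    chartDir (ContinuousLinearMap.id ℝ 𝕄) N (resDir N ψ) = ψ := by
  have h := extDir_resDir N hψP
  funext x κ
  have hx := congr_fun (congr_fun h x) κ
  simp only [extDir] at hx
  simp only [chartDir, ContinuousLinearMap.id_apply, resDir]
  exact hx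

end

end Summit.QuantumFields.BalabanUV.T4Continuum.AveragingDeficitTorusChart
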